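import Summits.QuantumFields.YangMills.Theorems.VirialFluxGapResolventFieldPointwise
import HarnessLib

/-!
# Route `VirialFluxGap` (YangMills): the STANDARD su(2) FRAME FAMILY of the ring group (one half-Pauli direction per variable) — slot
# norms, skewness, tracelessness, and coordinates of an arbitrary direction assignment

Toward the deciding crux `VirialFluxGap.PeriodicSoftness` (item stmt-QuantumFields-24141), generic-region Euler field (memo
`fcl-p3-g40-RESOLVENT-EULER-FIELD-24141.md`).  The master estimates ✓`FrameHessian.generic_drive_lower` ∕ ✓`generic_divergence_upper` are
stated for an arbitrary frame family `τ : ι → (Var → M₂(ℂ))` with unit slot norms; this file provides the STANDARD one, indexed by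
`ι = Var × Fin 3`: `τ_{(w,a)}` is the half-Pauli matrix `½·iσ_a` at the variable `w` and `0` elsewhere.

* §1 `halfPauli a` (`a : Fin 3`): skew-Hermitian, traceless, Frobenius norm `≤ 1`; ★ `halfPauli_expand` — every skew-Hermitian traceless
  `2×2` matrix is `Y = Σ_a c_a(Y)·halfPauli a` with the explicit real coordinates `pauliCoord Y = (2·Im Y₀₁, 2·Re Y₀₁, 2·Im Y₀₀)`, and
  `|c_a(Y)| ≤ 2‖Y‖`;
* §2 `stdFrame (w,a) = [w' ↦ if w' = w then halfPauli a else 0]`: skew, traceless, slot norms `≤ 1`; ★★ `dirOf_stdFrame_stdCoord` — every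
  skew-Hermitian traceless assignment `Y` equals `dirOf stdFrame (stdCoord Y)` with `stdCoord Y (w,a) = pauliCoord (Y w) a`, and
  ★ `stdCoord_sq_le` — `Σ_j (stdCoord Y j)² ≤ 12·Σ_w ‖Y w‖²` (so `|u|²` is controlled by the chordal size of the logarithm).

HONEST FRAMING: bookkeeping; ⟨24141⟩ stays OPEN; no stub / crux / rung / summit is closed; the Yang–Mills mass gap is NOT proved; no summit is
proved by a line.  Definitions (`halfPauli`, `pauliCoord`, `stdFrame`, `stdCoord`) are problem-side plumbing (no `Prop`); 0 `sorry`, standard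
axioms.  Explicit-unit seat `ym-line-fcl-p3` g40 (cell ym-idea-1, free hands), `--supports stmt-QuantumFields-24141`.  References: [folklore].
-/

set_option autoImplicit false

noncomputable section

open scoped Matrix BigOperators ContDiff Topology
open MeasureTheory Set Matrix
open Literature.MathematicalPhysics.QuantumFieldTheory hiding SU2
open Literature.MathematicalPhysics.QuantumLattice
open Literature.MathematicalPhysics.QuantumFieldTheory.SUNBakryEmery (expSU coe_expSU matTop)

namespace Summit.QuantumFields.YangMills.Theorems.VirialFluxGap.FrameHessian

open Summit.QuantumFields.YangMills.Theorems.FemtoTransferGap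
open Summit.QuantumFields.YangMills.Theorems.FemtoTransferGap.TT
open Summit.QuantumFields.YangMills.Theorems.VirialFluxGap.RingDeficit
open Summit.QuantumFields.YangMills.Theorems.VirialFluxGap.FrameDerivative

open scoped Matrix.Norms.Frobenius

attribute [local instance 2000] Literature.MathematicalPhysics.QuantumFieldTheory.SUNBakryEmery.matTop

/-! ## §1 The half-Pauli basis of `𝔰𝔲(2)` -/

/-- The half-Pauli matrices `½·iσ_x`, `½·iσ_y`, `½·iσ_z`. [folklore] -/
def halfPauli : Fin 3 → Matrix (Fin 2) (Fin 2) ℂ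
  | 0 => !![0, Complex.I / 2; Complex.I / 2, 0]
  | 1 => !![0, 1 / 2; -1 / 2, 0]
  | 2 => !![Complex.I / 2, 0; 0, -Complex.I / 2]

/-- The half-Pauli matrices are skew-Hermitian. [folklore] -/
theorem halfPauli_conjTranspose (a : Fin 3) : (halfPauli a)ᴴ = -halfPauli a := by
  fin_cases a <;>
  · ext i j
    fin_cases i <;> fin_cases j <;>
      simp [halfPauli, Matrix.conjTranspose_apply, Complex.ext_iff] <;> norm_num

/-- The half-Pauli matrices are traceless. [folklore] -/
theorem halfPauli_trace (a : Fin 3) : (halfPauli a).trace = 0 := by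
  fin_cases a
  · simp [halfPauli, Matrix.trace_fin_two]
  · simp [halfPauli, Matrix.trace_fin_two]
  · simp [halfPauli, Matrix.trace_fin_two]; ring

/-- The half-Pauli matrices have Frobenius norm at most `1` (in fact `1/√2`). [folklore] -/
theorem norm_halfPauli_le (a : Fin 3) : ‖halfPauli a‖ ≤ 1 := by
  have key : ∀ A : Matrix (Fin 2) (Fin 2) ℂ, (∀ i j, ‖A i j‖ ≤ 1 / 2) → ‖A‖ ≤ 1 := by
    intro A hA
    have h : ‖A‖₊ ≤ 1 := by
      rw [Matrix.frobenius_nnnorm_def]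
      have hsum : ∑ i, ∑ j, ‖A i j‖₊ ^ (2 : ℝ) ≤ 1 := by
        have hij : ∀ i j, ‖A i j‖₊ ^ (2 : ℝ) ≤ 1 / 4 := by
          intro i j
          have h1 : ‖A i j‖₊ ≤ 1 / 2 := by
            have := hA i j
            exact_mod_cast this
          calc ‖A i j‖₊ ^ (2 : ℝ) ≤ (1 / 2 : NNReal) ^ (2 : ℝ) := NNReal.rpow_le_rpow h1 (by norm_num)
            _ = 1 / 4 := by rw [NNReal.rpow_two]; norm_num
        calc ∑ i, ∑ j, ‖A i j‖₊ ^ (2 : ℝ) ≤ ∑ _i : Fin 2, ∑ _j : Fin 2, (1 / 4 : NNReal) :=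
            Finset.sum_le_sum fun i _ => Finset.sum_le_sum fun j _ => hij i j
          _ = 1 := by simp; norm_num
      calc (∑ i, ∑ j, ‖A i j‖₊ ^ (2 : ℝ)) ^ (1 / 2 : ℝ) ≤ (1 : NNReal) ^ (1 / 2 : ℝ) := NNReal.rpow_le_rpow hsum (by norm_num)
        _ = 1 := NNReal.one_rpow _
    exact_mod_cast h
  refine key _ fun i j => ?_
  fin_cases a <;> fin_cases i <;> fin_cases j <;> simp [halfPauli]

/-- The real coordinates of a `2×2` matrix in the half-Pauli basis: `(2·Im Y₀₁, 2·Re Y₀₁, 2·Im Y₀₀)`. [folklore] -/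
def pauliCoord (Y : Matrix (Fin 2) (Fin 2) ℂ) : Fin 3 → ℝ
  | 0 => 2 * (Y 0 1).im
  | 1 => 2 * (Y 0 1).re
  | 2 => 2 * (Y 0 0).im

/-- ★ Expansion of a skew-Hermitian traceless `2×2` matrix in the half-Pauli basis. [folklore] -/
theorem halfPauli_expand {Y : Matrix (Fin 2) (Fin 2) ℂ} (hY : Yᴴ = -Y) (hY0 : Y.trace = 0) :
    Y = ∑ a, pauliCoord Y a • halfPauli a := by
  -- entries of a skew-Hermitian traceless matrix
  have h00 := congr_fun (congr_fun hY 0) 0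
  have h01 := congr_fun (congr_fun hY 0) 1
  have h11 := congr_fun (congr_fun hY 1) 1
  simp only [Matrix.conjTranspose_apply, Matrix.neg_apply] at h00 h01 h11
  rw [Matrix.trace_fin_two] at hY0
  have hre00 : (Y 0 0).re = 0 := by
    have := congrArg Complex.re h00; simp at this; linarith
  have h10re : (Y 1 0).re = -(Y 0 1).re := by
    have := congrArg Complex.re h01; simp at this; linarith
  have h10im : (Y 1 0).im = (Y 0 1).im := by
    have := congrArg Complex.im h01; simp at this; linarith
  have h11re : (Y 1 1).re = 0 := by
    have := congrArg Complex.re hY0; simp at this; linarith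
  have h11im : (Y 1 1).im = -(Y 0 0).im := by
    have := congrArg Complex.im hY0; simp at this; linarith
  ext i j
  rw [Matrix.sum_apply, Fin.sum_univ_three]
  fin_cases i <;> fin_cases j <;>
    simp [halfPauli, pauliCoord, Matrix.smul_apply, Complex.ext_iff, hre00, h10re, h10im, h11re, h11im] <;>
    first
      | exact ⟨trivial, trivial⟩
      | (constructor <;> ring)
      | ring

/-- The half-Pauli coordinates are bounded by twice the Frobenius norm. [folklore] -/
theorem abs_pauliCoord_le (Y : Matrix (Fin 2) (Fin 2) ℂ) (a : Fin 3) : |pauliCoord Y a| ≤ 2 * ‖Y‖ := by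
  have hentry : ∀ i j, ‖Y i j‖ ≤ ‖Y‖ := by
    intro i j
    have h : ‖Y i j‖₊ ≤ ‖Y‖₊ := by
      rw [Matrix.frobenius_nnnorm_def]
      have h1 : ‖Y i j‖₊ ^ (2 : ℝ) ≤ ∑ i', ∑ j', ‖Y i' j'‖₊ ^ (2 : ℝ) :=
        le_trans (Finset.single_le_sum (f := fun j' => ‖Y i j'‖₊ ^ (2 : ℝ)) (fun _ _ => by positivity) (Finset.mem_univ j))
          (Finset.single_le_sum (f := fun i' => ∑ j', ‖Y i' j'‖₊ ^ (2 : ℝ)) (fun _ _ => by positivity) (Finset.mem_univ i))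
      calc ‖Y i j‖₊ = (‖Y i j‖₊ ^ (2 : ℝ)) ^ (1 / 2 : ℝ) := by rw [← NNReal.rpow_mul]; norm_num
        _ ≤ (∑ i', ∑ j', ‖Y i' j'‖₊ ^ (2 : ℝ)) ^ (1 / 2 : ℝ) := NNReal.rpow_le_rpow h1 (by norm_num)
    exact_mod_cast h
  have hre : ∀ i j, |(Y i j).re| ≤ ‖Y‖ := fun i j => (Complex.abs_re_le_norm _).trans (hentry i j)
  have him : ∀ i j, |(Y i j).im| ≤ ‖Y‖ := fun i j => (Complex.abs_im_le_norm _).trans (hentry i j)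
  fin_cases a <;>
  · simp only [pauliCoord, abs_mul, abs_two]
    first
      | linarith [him 0 1]
      | linarith [hre 0 1]
      | linarith [him 0 0]

/-! ## §2 The standard frame family of the ring group -/

variable {L : ℕ} [NeZero L]

omit [NeZero L] in
/-- The STANDARD FRAME FAMILY: the half-Pauli direction `a` at the variable `w`, zero elsewhere. [folklore] -/
def stdFrame (j : ((Fin (2 * L - 1 + 1) × Edge 3 L) ⊕ Site 3 L) × Fin 3) : ((Fin (2 * L - 1 + 1) × Edge 3 L) ⊕ Site 3 L) → Matrix (Fin 2) (Fin 2) ℂ :=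
  fun w => if w = j.1 then halfPauli j.2 else 0

omit [NeZero L] in
/-- The standard coordinates of a direction assignment. [folklore] -/
def stdCoord (Y : ((Fin (2 * L - 1 + 1) × Edge 3 L) ⊕ Site 3 L) → Matrix (Fin 2) (Fin 2) ℂ) (j : ((Fin (2 * L - 1 + 1) × Edge 3 L) ⊕ Site 3 L) × Fin 3) : ℝ := pauliCoord (Y j.1) j.2

omit [NeZero L] in
/-- The standard frame is skew-Hermitian slot by slot. [folklore] -/
theorem stdFrame_conjTranspose (j : ((Fin (2 * L - 1 + 1) × Edge 3 L) ⊕ Site 3 L) × Fin 3) (w : ((Fin (2 * L - 1 + 1) × Edge 3 L) ⊕ Site 3 L)) : (stdFrame j w)ᴴ = -stdFrame j w := by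
  unfold stdFrame
  split_ifs
  · exact halfPauli_conjTranspose _
  · simp

omit [NeZero L] in
/-- The standard frame is traceless slot by slot. [folklore] -/
theorem stdFrame_trace (j : ((Fin (2 * L - 1 + 1) × Edge 3 L) ⊕ Site 3 L) × Fin 3) (w : ((Fin (2 * L - 1 + 1) × Edge 3 L) ⊕ Site 3 L)) : (stdFrame j w).trace = 0 := by
  unfold stdFrame
  split_ifs
  · exact halfPauli_trace _
  · simp

omit [NeZero L] in
/-- The standard frame has slot norms `≤ 1`. [folklore] -/
theorem norm_stdFrame_le (j : ((Fin (2 * L - 1 + 1) × Edge 3 L) ⊕ Site 3 L) × Fin 3) (w : ((Fin (2 * L - 1 + 1) × Edge 3 L) ⊕ Site 3 L)) : ‖stdFrame j w‖ ≤ 1 := by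
  unfold stdFrame
  split_ifs
  · exact norm_halfPauli_le _
  · simp

/-- ★★ **Every skew-Hermitian traceless assignment is the standard-frame combination of its standard coordinates.** [folklore] -/
theorem dirOf_stdFrame_stdCoord {Y : ((Fin (2 * L - 1 + 1) × Edge 3 L) ⊕ Site 3 L) → Matrix (Fin 2) (Fin 2) ℂ} (hY : ∀ w, (Y w)ᴴ = -Y w) (hY0 : ∀ w, (Y w).trace = 0) :
    dirOf (stdFrame (L := L)) (stdCoord Y) = Y := by
  classical
  funext w
  rw [dirOf, Finset.sum_apply, Fintype.sum_prod_type]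
  simp only [Pi.smul_apply, stdFrame, stdCoord]
  rw [Finset.sum_eq_single w]
  · simp only [if_true]
    exact (halfPauli_expand (hY w) (hY0 w)).symm
  · intro w' _ hw'
    simp [Ne.symm hw']
  · intro h; exact absurd (Finset.mem_univ w) h

/-- ★ The standard coordinates are controlled by the slot norms: `Σ_j (stdCoord Y j)² ≤ 12·Σ_w ‖Y w‖²`. [folklore] -/
theorem stdCoord_sq_le (Y : ((Fin (2 * L - 1 + 1) × Edge 3 L) ⊕ Site 3 L) → Matrix (Fin 2) (Fin 2) ℂ) :
    (stdCoord (L := L) Y) ⬝ᵥ (stdCoord (L := L) Y) ≤ 12 * ∑ w, ‖Y w‖ ^ 2 := by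
  classical
  rw [dotProduct, Fintype.sum_prod_type, Finset.mul_sum]
  refine Finset.sum_le_sum fun w _ => ?_
  have h : ∀ a, stdCoord (L := L) Y (w, a) * stdCoord (L := L) Y (w, a) ≤ 4 * ‖Y w‖ ^ 2 := by
    intro a
    have hb := abs_pauliCoord_le (Y w) a
    have h0 : 0 ≤ ‖Y w‖ := norm_nonneg _
    rw [stdCoord, ← sq, ← sq_abs]
    calc |pauliCoord (Y w) a| ^ 2 ≤ (2 * ‖Y w‖) ^ 2 := pow_le_pow_left₀ (abs_nonneg _) hb 2
      _ = 4 * ‖Y w‖ ^ 2 := by ring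
  calc ∑ a, stdCoord (L := L) Y (w, a) * stdCoord (L := L) Y (w, a) ≤ ∑ _a : Fin 3, 4 * ‖Y w‖ ^ 2 :=
        Finset.sum_le_sum fun a _ => h a
    _ = 12 * ‖Y w‖ ^ 2 := by simp; ring

end Summit.QuantumFields.YangMills.Theorems.VirialFluxGap.FrameHessian

end
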